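/-
Origin: expansion seat `prover-pub-hodgecm-mc-binder-2-g11-0`, handover #41 2026-08-20T03:28Z md5 c21a13716eda (214 l.; CERTIFIED rc 0 / 0 warn / 100.9 s; imports #32 `CompactLetters` only; install after #32; §0 `continuous_noncommProd` (commuting finite products are continuous); §1 `cmPlaceOver_injective`, `letterSectionAt v` (tree `archPairSection v ∘ κ`), `commute_letterSectionAt` (distinct places commute, tree `commute_archSingle_of_archAt_eq_one`), **`letterSection : (Π_v DPK_v) →* arch J_V × arch J_W`** (`MonoidHom.noncommPiCoprod`), `letterSection_mulSingle`, `continuous_letterSection`, `cmPlaceComponent_letterSectionAt`, **`cmPlaceComponent_letterSection`** (`cmPlaceComponent v (letterSection h) = κ (h v)` — ENGINE hypothesis `hk` with `k v := eval v`, via `MonoidHom.pi_ext`); §2 **`exists_character_letterSection`** = ENGINE #32 applied to ALL compact letters at once: ONE continuous `χ : (Π_v DPK_v) →* Circle` with `ω_∞(letterSection h)(follandFock 𝔢 G) = χ h • follandFock 𝔢 (linSubst (star letters h) G)`; NAME LIST `HodgeCM.Model.HypCensus.letterSection`, `HodgeCM.Model.HypCensus.cmPlaceComponent_letterSection`, `HodgeCM.Model.HypCensus.exists_character_letterSection`;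 axioms trio) (`HOME/mc/pub-hodgecm-mc-binder-2/g11/pkg/HodgeCM/Model/HypCensus/LetterSection.lean`, md5 c21a13716eda, 219 lines);
landed by the gen-14 packager (p-g14) in gate run 39 as `HodgeCM/Model/HypCensus/LetterSection.lean` (verbatim).
-/
/-
Origin: speedrun cell pub-hodgecm, MODEL-CONSTRUCTION sub-cell, lineage mc-binder-2 (BINDER-OWNERS rows 18/19: E binders
`hyp12` / `hyp34` of `Model.perL_picardCM_r15A`), seat prover-pub-hodgecm-mc-binder-2-g11-0 (gen 11), 2026-08-20.
Target in PKG: `HodgeCM/Model/HypCensus/LetterSection.lean` (NEW additive leaf; imports this lineage's `HypCensus/CompactLetters` (#32)).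
KERNEL ONLY: 0 records, nothing cited as hypothesis, 0 `def … : Prop`; two defs + lemmas.
-/
import Summits.HodgeConjecture.HodgeCM.Model.HypCensus.CompactLetters

/-!
# Census kit (rows A12/A34), junction (J-x₀) step (b): THE LETTER SECTION — all place letters at once, as ONE archimedean pair

The compact-letter ENGINE (#32 `exists_character_cmArchWeilRep_follandFock`) takes a continuous `κ₀ : H →* U(J_V)(L⊗ℝ) × U(J_W)(L⊗ℝ)`
whose place components are compact letters `κ (k v h)`.  This leaf builds the UNIVERSAL such `κ₀`: `H := Π_v DPK_v` (all letters) and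
`κ₀ := letterSection`, the commuting product over the real places of the tree's place sections `archPairSection v ∘ κ`:

* `letterSectionAt v : DPK_v →* arch pair`, `commute_letterSectionAt` (distinct places commute — tree `commute_archSingle_of_archAt_eq_one`);
* **`letterSection : (Π_v DPK_v) →* arch pair`** (`MonoidHom.noncommPiCoprod`), `continuous_letterSection`, `letterSection_mulSingle`;
* **`cmPlaceComponent_letterSection`**: `cmPlaceComponent v (letterSection h) = κ (h v)` — the ENGINE's hypothesis `hk` with `k v := eval v`;
* **`exists_character_letterSection`**: the ENGINE applied — ONE continuous character `χ` of `Π_v DPK_v` with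
  `ω_∞(letterSection h)(follandFock 𝔢 G) = χ h • follandFock 𝔢 (G ∘ letters(h)†)`.

Every compact archimedean pair element (in particular `(frameG⁻¹ k frameG, 1)` for `k ∈ K_∞` block-diagonal at `ι₁`, #40) is a value of
`letterSection`; this is the form in which (J-x₀) `ins_mem` consumes the engine.  Nothing here is a claim of PerL/QW8.
-/

set_option autoImplicit false

noncomputable section

open NumberField NumberField.InfinitePlace
open scoped Matrix Classical
open MvPolynomial
open Literature.NumberTheory.Automorphic Literature.NumberTheory.Automorphic.UnitaryGroup Literature.NumberTheory.Weil1964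
open Literature.RepresentationTheory.KonnoKonno2007 Literature.RepresentationTheory.KonnoKonno2007.RealDualPair
open Literature.NumberTheory.GelbartRogawski1991 Literature.NumberTheory.GelbartRogawski1991.UnitaryDualPair
open Literature.Analysis.SegalBargmann

namespace HodgeCM.Model.HypCensus

/-! ## §0 continuity of a commuting finite product -/

section NoncommProd

variable {ι X M : Type*} [TopologicalSpace X] [Monoid M] [TopologicalSpace M] [ContinuousMul M]

/-- (Ported verbatim from the HodgeCMPerL package; no docstring in the source.) -/
theorem continuous_noncommProd (f : ι → X → M) (hf : ∀ i, Continuous (f i))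
    (hcomm : Pairwise fun i j => ∀ x, Commute (f i x) (f j x)) [DecidableEq ι] (s : Finset ι) :
    Continuous fun x => s.noncommProd (fun i => f i x) fun _ _ _ _ hij => hcomm hij x := by
  induction s using Finset.induction_on with
  | empty => simp only [Finset.noncommProd_empty]; exact continuous_const
  | insert a s ha ih =>
    simp only [Finset.noncommProd_insert_of_notMem _ _ _ _ ha]
    exact (hf a).mul ih

end NoncommProd

section LetterSection

variable (L : Type) [Field L] [NumberField L] [IsCMField L] {N M : ℕ}
variable (dV : Fin N → L) (hdV : ∀ i, IsCMField.complexConj L (dV i) = dV i) (hdV0 : ∀ i, dV i ≠ 0)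
variable (dW : Fin M → L) (hdW : ∀ i, IsCMField.complexConj L (dW i) = dW i) (hdW0 : ∀ i, dW i ≠ 0)
variable (ι₁ : L →+* ℂ)

/-- distinct real places of `L⁺` lie under distinct complex places of `L`. -/
theorem cmPlaceOver_injective : Function.Injective (cmPlaceOver L) := fun v v' h =>
  Subtype.ext (by rw [← cmPlaceOver_comap L v, ← cmPlaceOver_comap L v', h])

/-- the letter section at ONE real place: `DPK_v →* arch pair` (tree `archPairSection v` after Konno–Konno's `κ`). -/
def letterSectionAt (v : {v : InfinitePlace ↥(maximalRealSubfield L) // v.IsReal}) :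
    DPK (PosIdx (cmXV L dV hdV ι₁ v)) (NegIdx (cmXV L dV hdV ι₁ v)) (PosIdx (cmXW L dV dW hdW ι₁ v)) (NegIdx (cmXW L dV dW hdW ι₁ v)) →*
      UnitaryGroup.arch (↥(maximalRealSubfield L)) L (IsCMField.complexConj L) N (Matrix.diagonal dV) ×
        UnitaryGroup.arch (↥(maximalRealSubfield L)) L (IsCMField.complexConj L) M (Matrix.diagonal dW) :=
  (archPairSection L (IsCMField.complexConj L) N M (IsCMField.complexConj_ne_one L) (cmPlaceOver L) (cmPlaceOver_smul L)
      (cmPlaceOver_comap L) (cmRealVec L dV hdV) (cmRealVec L dW hdW) (realDiagonal_map L dV hdV).symm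
      (realDiagonal_map L dW hdW).symm (cmEpsV L dV hdV ι₁) (cmEpsW L dV dW hdW ι₁) (cmDV_ne_zero L dV hdV hdV0 ι₁)
      (cmDW_ne_zero L dV dW hdW hdW0 ι₁) (cmSignConv_ne_zero L dV ι₁) (cmCW_ne_zero L dV ι₁) (cm_htV L dV hdV hdV0 ι₁)
      (cm_htW L dV dW hdW hdW0 ι₁) (UnitaryGroup.complexConj_smul_infinitePlace L) v).comp
    (κ (PosIdx (cmXV L dV hdV ι₁ v)) (NegIdx (cmXV L dV hdV ι₁ v)) (PosIdx (cmXW L dV dW hdW ι₁ v)) (NegIdx (cmXW L dV dW hdW ι₁ v)))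

/-- (Ported verbatim from the HodgeCMPerL package; no docstring in the source.) -/
theorem letterSectionAt_apply (v : {v : InfinitePlace ↥(maximalRealSubfield L) // v.IsReal})
    (x : DPK (PosIdx (cmXV L dV hdV ι₁ v)) (NegIdx (cmXV L dV hdV ι₁ v)) (PosIdx (cmXW L dV dW hdW ι₁ v)) (NegIdx (cmXW L dV dW hdW ι₁ v))) :
    letterSectionAt L dV hdV hdV0 dW hdW hdW0 ι₁ v x =
      archPairSection L (IsCMField.complexConj L) N M (IsCMField.complexConj_ne_one L) (cmPlaceOver L) (cmPlaceOver_smul L)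
        (cmPlaceOver_comap L) (cmRealVec L dV hdV) (cmRealVec L dW hdW) (realDiagonal_map L dV hdV).symm
        (realDiagonal_map L dW hdW).symm (cmEpsV L dV hdV ι₁) (cmEpsW L dV dW hdW ι₁) (cmDV_ne_zero L dV hdV hdV0 ι₁)
        (cmDW_ne_zero L dV dW hdW hdW0 ι₁) (cmSignConv_ne_zero L dV ι₁) (cmCW_ne_zero L dV ι₁) (cm_htV L dV hdV hdV0 ι₁)
        (cm_htW L dV dW hdW hdW0 ι₁) (UnitaryGroup.complexConj_smul_infinitePlace L) v
        (κ (PosIdx (cmXV L dV hdV ι₁ v)) (NegIdx (cmXV L dV hdV ι₁ v)) (PosIdx (cmXW L dV dW hdW ι₁ v))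
          (NegIdx (cmXW L dV dW hdW ι₁ v)) x) := rfl

/-- (Ported verbatim from the HodgeCMPerL package; no docstring in the source.) -/
theorem continuous_letterSectionAt (v : {v : InfinitePlace ↥(maximalRealSubfield L) // v.IsReal}) :
    Continuous (letterSectionAt L dV hdV hdV0 dW hdW hdW0 ι₁ v) :=
  (continuous_archPairSection L (IsCMField.complexConj L) N M (IsCMField.complexConj_ne_one L) (cmPlaceOver L) (cmPlaceOver_smul L)
      (cmPlaceOver_comap L) (cmRealVec L dV hdV) (cmRealVec L dW hdW) (realDiagonal_map L dV hdV).symm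
      (realDiagonal_map L dW hdW).symm (cmEpsV L dV hdV ι₁) (cmEpsW L dV dW hdW ι₁) (cmDV_ne_zero L dV hdV hdV0 ι₁)
      (cmDW_ne_zero L dV dW hdW hdW0 ι₁) (cmSignConv_ne_zero L dV ι₁) (cmCW_ne_zero L dV ι₁) (cm_htV L dV hdV hdV0 ι₁)
      (cm_htW L dV dW hdW hdW0 ι₁) (UnitaryGroup.complexConj_smul_infinitePlace L) v).comp
    continuous_κ

/-- **letter sections at distinct places commute.** -/
theorem commute_letterSectionAt {v v' : {v : InfinitePlace ↥(maximalRealSubfield L) // v.IsReal}} (hv : v ≠ v')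
    (x : DPK (PosIdx (cmXV L dV hdV ι₁ v)) (NegIdx (cmXV L dV hdV ι₁ v)) (PosIdx (cmXW L dV dW hdW ι₁ v)) (NegIdx (cmXW L dV dW hdW ι₁ v)))
    (y : DPK (PosIdx (cmXV L dV hdV ι₁ v')) (NegIdx (cmXV L dV hdV ι₁ v')) (PosIdx (cmXW L dV dW hdW ι₁ v'))
      (NegIdx (cmXW L dV dW hdW ι₁ v'))) :
    Commute (letterSectionAt L dV hdV hdV0 dW hdW hdW0 ι₁ v x) (letterSectionAt L dV hdV hdV0 dW hdW hdW0 ι₁ v' y) := by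
  have hw : cmPlaceOver L v' ≠ cmPlaceOver L v := fun h => hv (cmPlaceOver_injective L h).symm
  rw [letterSectionAt_apply, letterSectionAt_apply, archPairSection_apply, archPairSection_apply, archPairSingle_apply,
    archPairSingle_apply]
  refine Prod.ext ?_ ?_
  · exact (commute_archSingle_of_archAt_eq_one (↥(maximalRealSubfield L)) L (IsCMField.complexConj L) N (Matrix.diagonal dV)
      (IsCMField.complexConj_ne_one L) (UnitaryGroup.complexConj_smul_infinitePlace L) (cmPlaceOver L v') _
      (archAt_archSingle_of_ne (↥(maximalRealSubfield L)) L (IsCMField.complexConj L) N (Matrix.diagonal dV)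
        (IsCMField.complexConj_ne_one L) (UnitaryGroup.complexConj_smul_infinitePlace L) (cmPlaceOver L v) hw _)).eq
  · exact (commute_archSingle_of_archAt_eq_one (↥(maximalRealSubfield L)) L (IsCMField.complexConj L) M (Matrix.diagonal dW)
      (IsCMField.complexConj_ne_one L) (UnitaryGroup.complexConj_smul_infinitePlace L) (cmPlaceOver L v') _
      (archAt_archSingle_of_ne (↥(maximalRealSubfield L)) L (IsCMField.complexConj L) M (Matrix.diagonal dW)
        (IsCMField.complexConj_ne_one L) (UnitaryGroup.complexConj_smul_infinitePlace L) (cmPlaceOver L v) hw _)).eq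

/-- **THE LETTER SECTION**: all place letters at once, `(Π_v DPK_v) →* U(J_V)(L⊗ℝ) × U(J_W)(L⊗ℝ)`. -/
def letterSection :
    (∀ v : {v : InfinitePlace ↥(maximalRealSubfield L) // v.IsReal},
        DPK (PosIdx (cmXV L dV hdV ι₁ v)) (NegIdx (cmXV L dV hdV ι₁ v)) (PosIdx (cmXW L dV dW hdW ι₁ v)) (NegIdx (cmXW L dV dW hdW ι₁ v))) →*
      UnitaryGroup.arch (↥(maximalRealSubfield L)) L (IsCMField.complexConj L) N (Matrix.diagonal dV) ×
        UnitaryGroup.arch (↥(maximalRealSubfield L)) L (IsCMField.complexConj L) M (Matrix.diagonal dW) :=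
  MonoidHom.noncommPiCoprod (fun v => letterSectionAt L dV hdV hdV0 dW hdW hdW0 ι₁ v)
    fun _ _ hvv' x y => commute_letterSectionAt L dV hdV hdV0 dW hdW hdW0 ι₁ hvv' x y

/-- (Ported verbatim from the HodgeCMPerL package; no docstring in the source.) -/
theorem letterSection_mulSingle (v : {v : InfinitePlace ↥(maximalRealSubfield L) // v.IsReal})
    (x : DPK (PosIdx (cmXV L dV hdV ι₁ v)) (NegIdx (cmXV L dV hdV ι₁ v)) (PosIdx (cmXW L dV dW hdW ι₁ v)) (NegIdx (cmXW L dV dW hdW ι₁ v))) :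
    letterSection L dV hdV hdV0 dW hdW hdW0 ι₁ (Pi.mulSingle v x) = letterSectionAt L dV hdV hdV0 dW hdW hdW0 ι₁ v x := by
  simp only [letterSection, MonoidHom.noncommPiCoprod_mulSingle]

/-- `letterSection` is continuous. -/
theorem continuous_letterSection : Continuous (letterSection L dV hdV hdV0 dW hdW hdW0 ι₁) := by
  have hc := continuous_noncommProd
    (fun v (h : ∀ v' : {v : InfinitePlace ↥(maximalRealSubfield L) // v.IsReal},
      DPK (PosIdx (cmXV L dV hdV ι₁ v')) (NegIdx (cmXV L dV hdV ι₁ v')) (PosIdx (cmXW L dV dW hdW ι₁ v')) (NegIdx (cmXW L dV dW hdW ι₁ v'))) =>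
      letterSectionAt L dV hdV hdV0 dW hdW hdW0 ι₁ v (h v))
    (fun v => (continuous_letterSectionAt L dV hdV hdV0 dW hdW hdW0 ι₁ v).comp (continuous_apply v))
    (fun _ _ hvv' h => commute_letterSectionAt L dV hdV hdV0 dW hdW hdW0 ι₁ hvv' _ _) Finset.univ
  convert hc using 1
  funext h
  rfl

/-- the place component of a ONE-place letter section: the letter at the place, `1` elsewhere. -/
theorem cmPlaceComponent_letterSectionAt (v v' : {v : InfinitePlace ↥(maximalRealSubfield L) // v.IsReal})
    (x : DPK (PosIdx (cmXV L dV hdV ι₁ v')) (NegIdx (cmXV L dV hdV ι₁ v')) (PosIdx (cmXW L dV dW hdW ι₁ v'))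
      (NegIdx (cmXW L dV dW hdW ι₁ v'))) :
    cmPlaceComponent L dV hdV hdV0 dW hdW hdW0 ι₁ v (letterSectionAt L dV hdV hdV0 dW hdW hdW0 ι₁ v' x) =
      Pi.mulSingle (M := fun v => Ginf (PosIdx (cmXV L dV hdV ι₁ v)) (NegIdx (cmXV L dV hdV ι₁ v)) (PosIdx (cmXW L dV dW hdW ι₁ v))
        (NegIdx (cmXW L dV dW hdW ι₁ v))) v'
        (κ (PosIdx (cmXV L dV hdV ι₁ v')) (NegIdx (cmXV L dV hdV ι₁ v')) (PosIdx (cmXW L dV dW hdW ι₁ v'))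
          (NegIdx (cmXW L dV dW hdW ι₁ v')) x) v :=
  congrFun (archPairPlace_archPairSection L (IsCMField.complexConj L) N M (IsCMField.complexConj_ne_one L) (cmPlaceOver L)
    (cmPlaceOver_smul L) (cmPlaceOver_comap L) (cmRealVec L dV hdV) (cmRealVec L dW hdW) (realDiagonal_map L dV hdV).symm
    (realDiagonal_map L dW hdW).symm (cmEpsV L dV hdV ι₁) (cmEpsW L dV dW hdW ι₁) (cmDV_ne_zero L dV hdV hdV0 ι₁)
    (cmDW_ne_zero L dV dW hdW hdW0 ι₁) (cmSignConv_ne_zero L dV ι₁) (cmCW_ne_zero L dV ι₁) (cm_htV L dV hdV hdV0 ι₁)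
    (cm_htW L dV dW hdW hdW0 ι₁) (UnitaryGroup.complexConj_smul_infinitePlace L) v' _) v

/-- **the place components of the letter section ARE the letters**: the ENGINE's hypothesis `hk` with `k v := eval v`. -/
theorem cmPlaceComponent_letterSection (v : {v : InfinitePlace ↥(maximalRealSubfield L) // v.IsReal})
    (h : ∀ v : {v : InfinitePlace ↥(maximalRealSubfield L) // v.IsReal},
      DPK (PosIdx (cmXV L dV hdV ι₁ v)) (NegIdx (cmXV L dV hdV ι₁ v)) (PosIdx (cmXW L dV dW hdW ι₁ v)) (NegIdx (cmXW L dV dW hdW ι₁ v))) :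
    cmPlaceComponent L dV hdV hdV0 dW hdW hdW0 ι₁ v (letterSection L dV hdV hdV0 dW hdW hdW0 ι₁ h) =
      κ (PosIdx (cmXV L dV hdV ι₁ v)) (NegIdx (cmXV L dV hdV ι₁ v)) (PosIdx (cmXW L dV dW hdW ι₁ v)) (NegIdx (cmXW L dV dW hdW ι₁ v))
        (h v) := by
  suffices H : (cmPlaceComponent L dV hdV hdV0 dW hdW hdW0 ι₁ v).comp (letterSection L dV hdV hdV0 dW hdW hdW0 ι₁) =
      (κ (PosIdx (cmXV L dV hdV ι₁ v)) (NegIdx (cmXV L dV hdV ι₁ v)) (PosIdx (cmXW L dV dW hdW ι₁ v))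
        (NegIdx (cmXW L dV dW hdW ι₁ v))).comp (Pi.evalMonoidHom _ v) from DFunLike.congr_fun H h
  refine MonoidHom.pi_ext fun v' x => ?_
  simp only [MonoidHom.comp_apply, Pi.evalMonoidHom_apply, letterSection_mulSingle]
  refine (cmPlaceComponent_letterSectionAt L dV hdV hdV0 dW hdW hdW0 ι₁ v v' x).trans ?_
  by_cases hv : v' = v
  · subst hv
    rw [Pi.mulSingle_eq_same, Pi.mulSingle_eq_same]
  · rw [Pi.mulSingle_eq_of_ne' hv, Pi.mulSingle_eq_of_ne' hv, map_one]

end LetterSection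

/-! ## §2 The ENGINE on the letter section -/

section Engine

variable (L : Type) [Field L] [NumberField L] [IsCMField L] {N M n : ℕ} (e : Fin N × Fin M ≃ Fin n)
variable (dV : Fin N → L) (hdV : ∀ i, IsCMField.complexConj L (dV i) = dV i) (hdV0 : ∀ i, dV i ≠ 0)
variable (dW : Fin M → L) (hdW : ∀ i, IsCMField.complexConj L (dW i) = dW i) (hdW0 : ∀ i, dW i ≠ 0)
variable (hGR : (cmSplittingDatum L e dV hdV hdV0 dW hdW hdW0).CompatibleSplitting) (ι₁ : L →+* ℂ)

/-- **ONE character for ALL compact letters**: `ω_∞(letterSection h)(follandFock 𝔢 G) = χ h • follandFock 𝔢 (G ∘ letters(h)†)`. -/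
theorem exists_character_letterSection
    (h₁V : ∃ i₀ : Fin N, (∀ i, i ≠ i₀ → 0 < (ι₁ (dV i)).re) ∨ ∀ i, i ≠ i₀ → (ι₁ (dV i)).re < 0)
    (h₁W : (∀ j, 0 < (ι₁ (dW j)).re) ∨ ∀ j, (ι₁ (dW j)).re < 0)
    (hV : ∀ τ : L →+* ℂ, InfinitePlace.mk τ ≠ InfinitePlace.mk ι₁ →
      (∀ i, 0 < (τ (dV i)).re) ∨ ∀ i, (τ (dV i)).re < 0)
    (hW : ∀ τ : L →+* ℂ, InfinitePlace.mk τ ≠ InfinitePlace.mk ι₁ →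
      (∃ j₀ : Fin M, ∀ j, j ≠ j₀ → 0 < (τ (dW j)).re) ∨ ∀ j, (τ (dW j)).re < 0) :
    ∃ χ : (∀ v : {v : InfinitePlace ↥(maximalRealSubfield L) // v.IsReal},
        DPK (PosIdx (cmXV L dV hdV ι₁ v)) (NegIdx (cmXV L dV hdV ι₁ v)) (PosIdx (cmXW L dV dW hdW ι₁ v))
          (NegIdx (cmXW L dV dW hdW ι₁ v))) →* Circle, Continuous χ ∧
      ∀ (h : ∀ v : {v : InfinitePlace ↥(maximalRealSubfield L) // v.IsReal},
          DPK (PosIdx (cmXV L dV hdV ι₁ v)) (NegIdx (cmXV L dV hdV ι₁ v)) (PosIdx (cmXW L dV dW hdW ι₁ v))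
            (NegIdx (cmXW L dV dW hdW ι₁ v)))
        (G : MvPolynomial (Fin n × {v : InfinitePlace ↥(maximalRealSubfield L) // v.IsReal}) ℂ),
        cmArchWeilRep L e dV hdV hdV0 dW hdW hdW0 hGR (letterSection L dV hdV hdV0 dW hdW hdW0 ι₁ h)
            (follandFock (cmBigFrame L e dV hdV hdV0 dW hdW hdW0 ι₁) G) =
          ((χ h : Circle) : ℂ) •
            follandFock (cmBigFrame L e dV hdV hdV0 dW hdW hdW0 ι₁)
              (linSubst (star ((cmLetterBlock L e dV hdV dW hdW ι₁ (fun v => Pi.evalMonoidHom _ v) h :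
                Matrix.unitaryGroup (Fin n × {v : InfinitePlace ↥(maximalRealSubfield L) // v.IsReal}) ℂ) :
                  Matrix _ _ ℂ)) G) :=
  exists_character_cmArchWeilRep_follandFock L e dV hdV hdV0 dW hdW hdW0 hGR ι₁ h₁V h₁W hV hW
    (letterSection L dV hdV hdV0 dW hdW hdW0 ι₁) (continuous_letterSection L dV hdV hdV0 dW hdW hdW0 ι₁)
    (fun v => Pi.evalMonoidHom _ v) (cmPlaceComponent_letterSection L dV hdV hdV0 dW hdW hdW0 ι₁)

end Engine

end HodgeCM.Model.HypCensus

end
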